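import Summits.QuantumFields.YangMills.Theorems.BalabanUVNodesN15KingModelHeatKernelSymbolDerivatives
import Summits.QuantumFields.YangMills.Theorems.BalabanUVNodesN15KingModelHeatKernelForwardDifferenceMVT
import Summits.QuantumFields.YangMills.Theorems.BalabanUVNodesN15KingModelHeatKernelGaussianSums
import HarnessLib

/-!
# BalabanUVNodes ∕ N15 — THE KING-MODEL RUNG (PART Ϣ-d): THE HEAT KERNEL OF THE CYCLE `ℤ∕K` —
# `Q^{(K)}_s(n) = K⁻¹Σ_{k∈ℤ∕K} e^{−s(2−2cos(2πv(k)∕K))}·ψ(kn)`: `‖Q_s(n)‖ ≤ Q_s(0) ≤ min(1, 1∕K + e^{−8s∕K²}√(π∕(8s)))`, and FOUR SUMMATIONS BY PARTS `(ψ(−n)−1)^j·Σ_k f(k)ψ(kn) = Σ_k (Δ^j f)(k)ψ(kn)`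
# with `‖ψ(−n) − 1‖ ≥ 4|v(n)|∕K` and the pull-back `Δ_[1]^[j](F∘θ) = (Δ_[2π∕K]^[j]F)∘θ` for `2π`-periodic `F` (the one-dimensional factor of PART Ϣ's subordination formula)
# (Track A, DAG node N15 = NE2; FAN-OUT v1.1 §N15 s3 «KING-MODEL RUNG … + what the curved case adds»; count-neutral)

HONEST FRAMING.  Count-neutral (cell `pub-ymgap`, seat `pub-ymgap-dag-n15-e` g55; `--supports stmt-QuantumFields-27247 --as helper` = K3ᴬ).  King's `A = 0` covariance on the torus
`Π_μℤ∕K_μ` is `(lapF K c m²)⁻¹ = |Ω|⁻¹Σ_q lapSym(q)⁻¹χ_q` (Ε-e `lapF_inv_eq_kingPlaneWave`, (4.4)∕(4.35)); PART Ϣ writes `lapSym⁻¹ = ∫₀^∞e^{−t·lapSym}dt` and FACTORISES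
`|Ω|⁻¹Σ_q e^{−t·lapSym(q)}χ_q(z) = e^{−tm²}Π_μ Q^{(K_μ)}_{ct}(z_μ)` (PART Ϣ-f) into the ONE-DIMENSIONAL objects of this file: ★ `cycleHeat K s n := K⁻¹Σ_k e^{−s(2−2cos θ_k)}ψ_K(kn)`,
`θ_k = cycAngle K k = 2πv(k)∕K` (`v = valMinAbs`, King's reduced momentum (4.4)), `ψ_K = ZMod.stdAddChar`.  Everything here is finite sums on `ℤ∕K` plus PART Ϣ-b∕Ϣ-c; no integrals.
CONTENTS.  §1 defs `cycAngle`, `cycleHeat`; `norm_stdAddChar_eq_one`; ★ `norm_cycleHeat_le_diag` (`‖Q_s(n)‖ ≤ K⁻¹Σ_k e^{−s(2−2cos θ_k)}` — the diagonal dominates), ★ `norm_cycleHeat_le_one`,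
★★ **`norm_cycleHeat_le_mixing`** (`≤ 1∕K + e^{−8s∕K²}√(π∕(8s))`, Ϣ-c `cycle_symbol_sum_le`), `cycleHeat_continuous` (in `s`); §2 THE CHARACTER STEP: `stdAddChar_neg_valMinAbs`,
★ `norm_stdAddChar_neg_sub_one` (`‖ψ(−n)−1‖ = 2|sin(πv(n)∕K)|`), ★★ **`norm_stdAddChar_neg_sub_one_ge`** (`≥ 4|v(n)|∕K`, Jordan `sin y ≥ (2∕π)y` on `[0,π∕2]`); §3 SUMMATION BY PARTS on
`ℤ∕K`: `charSum_shift` (`Σ_k f(k+1)ψ(kn) = ψ(−n)Σ_k f(k)ψ(kn)`), ★ `charSum_fwdDiff` (`Σ_k(Δ_[1]f)(k)ψ(kn) = (ψ(−n)−1)Σ_kf(k)ψ(kn)`), ★★ **`charSum_iterate_fwdDiff`** (`j` times);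
§4 THE PULL-BACK of `2π`-periodic functions along `θ`: `exists_cycAngle_add_one` (`θ_{k+1} = θ_k + 2π∕K + 2πm`), ★ `pull_add_one`, ★★ **`iterate_fwdDiff_pull`**
(`Δ_[1]^[j](F∘θ)(k) = Δ_[2π∕K]^[j]F(θ_k)`), `ofReal_iterate_fwdDiff`; §5 the symbol is the tree's heat symbol: `exp_symbol_eq_heat` (`e^{−s(2−2cos θ)} = heat (2s) θ`), and ★★★
**`norm_cycleHeat_le_of_fourth_difference`**: for `n ≠ 0`, `‖Q_s(n)‖ ≤ (K∕(4|v(n)|))⁴ · K⁻¹Σ_k |Δ_[2π∕K]^[4](heat(2s))(θ_k)|` — the decay bound of PART Ϣ-e is this with Ϣ-a∕Ϣ-b∕Ϣ-c.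
PRIOR TREE ART (by name): Mathlib `ZMod.stdAddChar` ∕ `stdAddChar_coe` ∕ `Circle.norm_coe` ∕ `AddChar.map_add_eq_mul` ∕ `Complex.norm_exp_I_mul_ofReal_sub_one` ∕ `Real.mul_le_sin` ∕ `fwdDiff`;
`B5Prop11Plancherel.chi` is the `(d+1)`-fold product of these characters (PART Ϣ-f makes the identification); the tree's `SRWGreen.heat` (PART Ϣ-a).
Dedup (rg at filing): basename 0 files; needles `cycAngle|cycleHeat|norm_cycleHeat|charSum_fwdDiff|charSum_iterate_fwdDiff|iterate_fwdDiff_pull|norm_stdAddChar_neg_sub_one` 0 tree files.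
Locators: [King1986] (4.4) p.670 (symbol and reduced momenta), (4.35) p.674 (plane-wave sums), (2.13) p.653; [Balaban1984PropagatorsI] (1.29) p.23 (finite Fourier inversion on the torus);
[LawlerLimic2010] §2.3 (method).  0 `sorry`; 2 `def` (`cycAngle`, `cycleHeat`).
-/

noncomputable section

open Real Set Finset Complex fwdDiff
open scoped BigOperators

namespace Summit.QuantumFields.YangMills.BalabanUVNodes.N15KingModelRung.HeatKernel

open Literature.Barriers.CriticalPhenomena.SRWGreen (heat heat_le_one heat_pos)

variable (K : ℕ) [NeZero K]

/-! ## §1 The cycle heat kernel and its diagonal bounds -/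

/-- King's reduced momentum on the cycle: `θ_k = 2π·v(k)∕K`, `v(k) = valMinAbs k ∈ (−K∕2, K∕2]`. [cite: King1986, (4.4) p.670] -/
def cycAngle (k : ZMod K) : ℝ := 2 * π * (k.valMinAbs : ℝ) / K

/-- ★ THE HEAT KERNEL OF THE CYCLE `ℤ∕K` at time `s` (generator `2 − 2cos`, i.e. the symbol of `−Δ` in one direction): `Q_s(n) = K⁻¹Σ_{k∈ℤ∕K} e^{−s(2−2cos θ_k)}·ψ_K(k·n)`.
[cite: King1986, (4.4) p.670, (4.35) p.674; Balaban1984PropagatorsI, (1.29) p.23] -/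
def cycleHeat (s : ℝ) (n : ZMod K) : ℂ :=
  (K : ℂ)⁻¹ * ∑ k : ZMod K, ((Real.exp (-(s * (2 - 2 * Real.cos (cycAngle K k)))) : ℝ) : ℂ) * ZMod.stdAddChar (k * n)

variable {K}

/-- `‖ψ_K(x)‖ = 1`. [folklore] -/
theorem norm_stdAddChar_eq_one (x : ZMod K) : ‖(ZMod.stdAddChar x : ℂ)‖ = 1 := by
  rw [ZMod.stdAddChar_apply]; exact Circle.norm_coe _

/-- ★ THE DIAGONAL DOMINATES: `‖Q_s(n)‖ ≤ K⁻¹Σ_k e^{−s(2−2cos θ_k)}` (`= Q_s(0)`). [cite: King1986, (4.35) p.674] -/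
theorem norm_cycleHeat_le_diag (s : ℝ) (n : ZMod K) :
    ‖cycleHeat K s n‖ ≤ (K : ℝ)⁻¹ * ∑ k : ZMod K, Real.exp (-(s * (2 - 2 * Real.cos (cycAngle K k)))) := by
  unfold cycleHeat
  rw [norm_mul, norm_inv]
  have hK : ‖(K : ℂ)‖ = (K : ℝ) := by simp
  rw [hK]
  refine mul_le_mul_of_nonneg_left ((norm_sum_le _ _).trans (le_of_eq ?_)) (by positivity)
  refine Finset.sum_congr rfl fun k _ => ?_
  rw [norm_mul, norm_stdAddChar_eq_one, mul_one, Complex.norm_real, Real.norm_eq_abs, abs_of_pos (Real.exp_pos _)]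

/-- ★ `‖Q_s(n)‖ ≤ 1` for `s ≥ 0`. [folklore] -/
theorem norm_cycleHeat_le_one {s : ℝ} (hs : 0 ≤ s) (n : ZMod K) : ‖cycleHeat K s n‖ ≤ 1 :=
  (norm_cycleHeat_le_diag s n).trans (cycle_symbol_sum_le_one hs)

/-- ★★ **THE MIXING BOUND**: `‖Q_s(n)‖ ≤ 1∕K + e^{−8s∕K²}·√(π∕(8s))` for `s > 0` (PART Ϣ-c `cycle_symbol_sum_le`). [cite: King1986, (4.4) p.670, (4.35) p.674] -/
theorem norm_cycleHeat_le_mixing {s : ℝ} (hs : 0 < s) (n : ZMod K) :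
    ‖cycleHeat K s n‖ ≤ (K : ℝ)⁻¹ + Real.exp (-(8 * s / (K : ℝ) ^ 2)) * Real.sqrt (π / (8 * s)) :=
  (norm_cycleHeat_le_diag s n).trans (cycle_symbol_sum_le hs)

/-- The coarse form: `‖Q_s(n)‖ ≤ 1∕K + √(π∕(8s))`. [folklore] -/
theorem norm_cycleHeat_le_mixing' {s : ℝ} (hs : 0 < s) (n : ZMod K) :
    ‖cycleHeat K s n‖ ≤ (K : ℝ)⁻¹ + Real.sqrt (π / (8 * s)) :=
  (norm_cycleHeat_le_diag s n).trans (cycle_symbol_sum_le' hs)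

/-- `0 ≤ ‖Q_s(n)‖` packaged with the upper bound `1` as membership in `[0,1]`. [folklore] -/
theorem norm_cycleHeat_mem_Icc {s : ℝ} (hs : 0 ≤ s) (n : ZMod K) : ‖cycleHeat K s n‖ ∈ Icc (0 : ℝ) 1 :=
  ⟨norm_nonneg _, norm_cycleHeat_le_one hs n⟩

/-- `s ↦ Q_s(n)` is continuous. [folklore] -/
theorem continuous_cycleHeat (n : ZMod K) : Continuous fun s : ℝ => cycleHeat K s n := by
  unfold cycleHeat
  refine continuous_const.mul (continuous_finsetSum _ fun k _ => ?_)
  refine Continuous.mul ?_ continuous_const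
  exact Complex.continuous_ofReal.comp (Real.continuous_exp.comp (by fun_prop))

/-! ## §2 The character step `‖ψ(−n) − 1‖ ≥ 4|v(n)|∕K` -/

/-- `ψ_K(−n) = e^{−2πi·v(n)∕K}`. [folklore] -/
theorem stdAddChar_neg_valMinAbs (n : ZMod K) :
    (ZMod.stdAddChar (-n) : ℂ) = Complex.exp (Complex.I * (((-(2 * π * (n.valMinAbs : ℝ) / K) : ℝ) : ℂ))) := by
  have h : (-n : ZMod K) = (((-n.valMinAbs : ℤ)) : ZMod K) := by
    rw [Int.cast_neg, ZMod.coe_valMinAbs]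
  rw [h, ZMod.stdAddChar_coe]
  congr 1
  push_cast
  ring

/-- ★ `‖ψ_K(−n) − 1‖ = 2|sin(πv(n)∕K)|`. [folklore] -/
theorem norm_stdAddChar_neg_sub_one (n : ZMod K) :
    ‖(ZMod.stdAddChar (-n) : ℂ) - 1‖ = 2 * |Real.sin (π * (n.valMinAbs : ℝ) / K)| := by
  rw [stdAddChar_neg_valMinAbs, Complex.norm_exp_I_mul_ofReal_sub_one]
  rw [Real.norm_eq_abs, abs_mul, abs_two]
  congr 1
  rw [show -(2 * π * (n.valMinAbs : ℝ) / K) / 2 = -(π * (n.valMinAbs : ℝ) / K) by ring, Real.sin_neg, abs_neg]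

/-- ★★ **JORDAN FOR THE CHARACTER**: `‖ψ_K(−n) − 1‖ ≥ 4|v(n)|∕K` (`|sin y| ≥ (2∕π)|y|` for `|y| ≤ π∕2`, at `y = πv(n)∕K`, `|v(n)| ≤ K∕2`). [cite: King1986, proof of Lemma 4.1 p.671] -/
theorem norm_stdAddChar_neg_sub_one_ge (n : ZMod K) :
    4 * ((n.valMinAbs.natAbs : ℕ) : ℝ) / K ≤ ‖(ZMod.stdAddChar (-n) : ℂ) - 1‖ := by
  have hK : (0 : ℝ) < K := by exact_mod_cast Nat.pos_of_ne_zero (NeZero.ne K)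
  rw [norm_stdAddChar_neg_sub_one]
  -- `|v| ≤ K/2`
  have habs : |(n.valMinAbs : ℝ)| ≤ (K : ℝ) / 2 := by
    have h1 : ((n.valMinAbs.natAbs : ℕ) : ℝ) ≤ ((K / 2 : ℕ) : ℝ) := by exact_mod_cast ZMod.natAbs_valMinAbs_le n
    rw [Nat.cast_natAbs, Int.cast_abs] at h1
    exact h1.trans Nat.cast_div_le
  have hv : ((n.valMinAbs.natAbs : ℕ) : ℝ) = |(n.valMinAbs : ℝ)| := by rw [Nat.cast_natAbs, Int.cast_abs]
  rw [hv]
  -- `y = π|v|/K ∈ [0, π/2]`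
  set y : ℝ := π * |(n.valMinAbs : ℝ)| / K with hy
  have hy0 : 0 ≤ y := by positivity
  have hy1 : y ≤ π / 2 := by
    rw [hy, div_le_iff₀ hK]
    have := mul_le_mul_of_nonneg_left habs Real.pi_pos.le
    linarith
  have hj := Real.mul_le_sin hy0 hy1
  -- `|sin(πv/K)| = sin y`
  have hyπ : y ≤ π := hy1.trans (by linarith [Real.pi_pos])
  have hsy : 0 ≤ Real.sin y := Real.sin_nonneg_of_nonneg_of_le_pi hy0 hyπ
  have hcases : π * (n.valMinAbs : ℝ) / K = y ∨ π * (n.valMinAbs : ℝ) / K = -y := by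
    rcases le_or_gt 0 (n.valMinAbs : ℝ) with h | h
    · left; rw [hy, abs_of_nonneg h]
    · right; rw [hy, abs_of_neg h]; ring
  have hsin : |Real.sin (π * (n.valMinAbs : ℝ) / K)| = Real.sin y := by
    rcases hcases with h | h
    · rw [h, abs_of_nonneg hsy]
    · rw [h, Real.sin_neg, abs_neg, abs_of_nonneg hsy]
  rw [hsin]
  have e : 4 * |(n.valMinAbs : ℝ)| / K = 2 * (2 / π * y) := by rw [hy]; field_simp; ring
  rw [e]
  linarith

/-- Hence for `n ≠ 0` the character step is invertible: `0 < ‖ψ_K(−n) − 1‖`. [folklore] -/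
theorem norm_stdAddChar_neg_sub_one_pos {n : ZMod K} (hn : n ≠ 0) : 0 < ‖(ZMod.stdAddChar (-n) : ℂ) - 1‖ := by
  have hK : (0 : ℝ) < K := by exact_mod_cast Nat.pos_of_ne_zero (NeZero.ne K)
  refine lt_of_lt_of_le ?_ (norm_stdAddChar_neg_sub_one_ge n)
  have hv : 0 < n.valMinAbs.natAbs := by
    rw [Nat.pos_iff_ne_zero, Ne, Int.natAbs_eq_zero, ZMod.valMinAbs_eq_zero]; exact hn
  have : (0 : ℝ) < ((n.valMinAbs.natAbs : ℕ) : ℝ) := by exact_mod_cast hv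
  positivity

/-! ## §3 Summation by parts on `ℤ∕K` -/

/-- SHIFT: `Σ_k f(k+1)ψ(kn) = ψ(−n)·Σ_k f(k)ψ(kn)`. [folklore] -/
theorem charSum_shift (f : ZMod K → ℂ) (n : ZMod K) :
    ∑ k : ZMod K, f (k + 1) * ZMod.stdAddChar (k * n) = ZMod.stdAddChar (-n) * ∑ k : ZMod K, f k * ZMod.stdAddChar (k * n) := by
  have h : ∑ k : ZMod K, f (k + 1) * ZMod.stdAddChar ((k + 1 - 1) * n) = ∑ k : ZMod K, f k * ZMod.stdAddChar ((k - 1) * n) :=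
    Fintype.sum_equiv (Equiv.addRight (1 : ZMod K)) _ _ (fun k => rfl)
  simp only [add_sub_cancel_right] at h
  rw [h, Finset.mul_sum]
  refine Finset.sum_congr rfl fun k _ => ?_
  rw [show (k - 1) * n = k * n + (-n) by ring, AddChar.map_add_eq_mul]
  ring

/-- ★ ONE SUMMATION BY PARTS: `Σ_k (Δ_[1]f)(k)ψ(kn) = (ψ(−n) − 1)·Σ_k f(k)ψ(kn)`. [folklore] -/
theorem charSum_fwdDiff (f : ZMod K → ℂ) (n : ZMod K) :
    ∑ k : ZMod K, (Δ_[1] f) k * ZMod.stdAddChar (k * n) = (ZMod.stdAddChar (-n) - 1) * ∑ k : ZMod K, f k * ZMod.stdAddChar (k * n) := by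
  simp only [fwdDiff, sub_mul, Finset.sum_sub_distrib]
  rw [charSum_shift, one_mul]

/-- ★★ **`j` SUMMATIONS BY PARTS**: `Σ_k (Δ_[1]^[j]f)(k)ψ(kn) = (ψ(−n) − 1)^j·Σ_k f(k)ψ(kn)`. [folklore] -/
theorem charSum_iterate_fwdDiff (j : ℕ) : ∀ (f : ZMod K → ℂ) (n : ZMod K),
    ∑ k : ZMod K, ((Δ_[1])^[j] f) k * ZMod.stdAddChar (k * n) = (ZMod.stdAddChar (-n) - 1) ^ j * ∑ k : ZMod K, f k * ZMod.stdAddChar (k * n) := by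
  induction j with
  | zero => intro f n; simp
  | succ j ih =>
    intro f n
    rw [Function.iterate_succ_apply, ih (Δ_[1] f) n, charSum_fwdDiff, pow_succ]
    ring

/-! ## §4 Pulling `2π`-periodic functions back along `θ` -/

/-- `θ_{k+1} = θ_k + 2π∕K + 2πm` for some integer `m` (`v(k+1) ≡ v(k) + 1 (mod K)`). [folklore] -/
theorem exists_cycAngle_add_one (k : ZMod K) : ∃ m : ℤ, cycAngle K (k + 1) = cycAngle K k + 2 * π / K + m * (2 * π) := by
  have hK : (K : ℝ) ≠ 0 := by exact_mod_cast (NeZero.ne K)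
  have h : (((k + 1).valMinAbs : ℤ) : ZMod K) = (((k.valMinAbs + 1 : ℤ)) : ZMod K) := by
    rw [ZMod.coe_valMinAbs, Int.cast_add, ZMod.coe_valMinAbs, Int.cast_one]
  rw [ZMod.intCast_eq_intCast_iff_dvd_sub] at h
  obtain ⟨m, hm⟩ := h
  refine ⟨-m, ?_⟩
  unfold cycAngle
  have hm' : ((k + 1).valMinAbs : ℝ) = (k.valMinAbs : ℝ) + 1 - (K : ℝ) * m := by
    have := congrArg (fun z : ℤ => (z : ℝ)) hm
    push_cast at this
    linarith
  rw [hm']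
  push_cast
  field_simp
  ring

/-- ★ THE PULL-BACK SHIFTS HONESTLY: for a `2π`-periodic `F`, `F(θ_{k+1}) = F(θ_k + 2π∕K)`. [folklore] -/
theorem pull_add_one {F : ℝ → ℝ} (hF : Function.Periodic F (2 * π)) (k : ZMod K) :
    F (cycAngle K (k + 1)) = F (cycAngle K k + 2 * π / K) := by
  obtain ⟨m, hm⟩ := exists_cycAngle_add_one (K := K) k
  rw [hm]
  exact hF.int_mul m _

/-- ★★ **ITERATED DIFFERENCES PULL BACK**: for a `2π`-periodic `F` and every `j`, `Δ_[1]^[j](k ↦ F(θ_k))(k) = (Δ_[2π∕K]^[j]F)(θ_k)`. [folklore] -/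
theorem iterate_fwdDiff_pull {F : ℝ → ℝ} (hF : Function.Periodic F (2 * π)) (j : ℕ) (k : ZMod K) :
    (Δ_[(1 : ZMod K)])^[j] (fun k' => F (cycAngle K k')) k = (Δ_[2 * π / K])^[j] F (cycAngle K k) := by
  induction j generalizing k with
  | zero => rfl
  | succ j ih =>
    rw [Function.iterate_succ_apply', Function.iterate_succ_apply']
    simp only [fwdDiff]
    rw [ih (k + 1), ih k]
    -- `Δ^[j] F` is periodic, so the shift is honest
    have hper := iterate_fwdDiff_periodic hF (2 * π / K) j
    rw [pull_add_one (K := K) hper k]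

/-- Casting to `ℂ` commutes with iterated differences. [folklore] -/
theorem ofReal_iterate_fwdDiff {M : Type*} [AddCommMonoid M] (h : M) (j : ℕ) : ∀ (g : M → ℝ) (k : M),
    (((Δ_[h])^[j] g k : ℝ) : ℂ) = (Δ_[h])^[j] (fun k' => ((g k' : ℝ) : ℂ)) k := by
  induction j with
  | zero => intro g k; rfl
  | succ j ih =>
    intro g k
    rw [Function.iterate_succ_apply, Function.iterate_succ_apply, ih (Δ_[h] g) k]
    have e : (fun k' => ((Δ_[h] g k' : ℝ) : ℂ)) = Δ_[h] (fun k' => ((g k' : ℝ) : ℂ)) := by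
      funext k'; simp [fwdDiff]
    rw [e]

/-! ## §5 The symbol is the tree's heat symbol; the norm through fourth differences -/

/-- `e^{−s(2−2cos θ)} = heat (2s) θ` (the tree's rate-one symbol at doubled time). [cite: King1986, (4.4) p.670] -/
theorem exp_symbol_eq_heat (s θ : ℝ) : Real.exp (-(s * (2 - 2 * Real.cos θ))) = heat (2 * s) θ := by
  unfold heat; ring_nf

/-- `Q_s(n)` with the symbol spelled as the pulled-back heat symbol. [cite: King1986, (4.4) p.670] -/
theorem cycleHeat_eq_heat_sum (s : ℝ) (n : ZMod K) :
    cycleHeat K s n = (K : ℂ)⁻¹ * ∑ k : ZMod K, ((heat (2 * s) (cycAngle K k) : ℝ) : ℂ) * ZMod.stdAddChar (k * n) := by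
  unfold cycleHeat
  simp_rw [exp_symbol_eq_heat]

/-- ★★★ **THE NORM OF THE CYCLE HEAT KERNEL THROUGH FOURTH DIFFERENCES**: for `n ≠ 0`,
`‖Q_s(n)‖ ≤ ‖ψ(−n)−1‖⁻⁴ · K⁻¹Σ_k |Δ_[2π∕K]^[4](heat(2s))(θ_k)|` (four summations by parts, the pull-back, and `|ψ| = 1`). [cite: King1986, (4.4) p.670, (4.35) p.674] -/
theorem norm_cycleHeat_le_of_fourth_difference (s : ℝ) {n : ZMod K} (hn : n ≠ 0) :
    ‖cycleHeat K s n‖ ≤ (‖(ZMod.stdAddChar (-n) : ℂ) - 1‖ ^ 4)⁻¹ *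
      ((K : ℝ)⁻¹ * ∑ k : ZMod K, |(Δ_[2 * π / K])^[4] (heat (2 * s)) (cycAngle K k)|) := by
  have hK : (0 : ℝ) < K := by exact_mod_cast Nat.pos_of_ne_zero (NeZero.ne K)
  have hψ := norm_stdAddChar_neg_sub_one_pos (K := K) hn
  have hψ4 : 0 < ‖(ZMod.stdAddChar (-n) : ℂ) - 1‖ ^ 4 := pow_pos hψ 4
  set f : ZMod K → ℂ := fun k => ((heat (2 * s) (cycAngle K k) : ℝ) : ℂ) with hf
  -- four summations by parts
  have hsbp := charSum_iterate_fwdDiff (K := K) 4 f n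
  have hS : ∑ k : ZMod K, f k * ZMod.stdAddChar (k * n)
      = ((ZMod.stdAddChar (-n) - 1) ^ 4)⁻¹ * ∑ k : ZMod K, ((Δ_[1])^[4] f) k * ZMod.stdAddChar (k * n) := by
    rw [hsbp, ← mul_assoc, inv_mul_cancel₀ (pow_ne_zero 4 (norm_pos_iff.mp hψ)), one_mul]
  -- the pulled-back fourth differences
  have hpull : ∀ k : ZMod K, ((Δ_[1])^[4] f) k = (((Δ_[2 * π / K])^[4] (heat (2 * s)) (cycAngle K k) : ℝ) : ℂ) := by
    intro k
    rw [hf, ← ofReal_iterate_fwdDiff (1 : ZMod K) 4 (fun k' => heat (2 * s) (cycAngle K k')) k,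
      iterate_fwdDiff_pull (Literature.Barriers.CriticalPhenomena.SRWGreen.heat_periodic (2 * s)) 4 k]
  rw [cycleHeat_eq_heat_sum, hS, norm_mul, norm_mul, norm_inv, norm_inv, norm_pow]
  have hKn : ‖(K : ℂ)‖ = (K : ℝ) := by simp
  rw [hKn]
  have hsum : ‖∑ k : ZMod K, ((Δ_[1])^[4] f) k * ZMod.stdAddChar (k * n)‖ ≤ ∑ k : ZMod K, |(Δ_[2 * π / K])^[4] (heat (2 * s)) (cycAngle K k)| := by
    refine (norm_sum_le _ _).trans (le_of_eq (Finset.sum_congr rfl fun k _ => ?_))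
    rw [norm_mul, norm_stdAddChar_eq_one, mul_one, hpull k, Complex.norm_real, Real.norm_eq_abs]
  calc (K : ℝ)⁻¹ * ((‖(ZMod.stdAddChar (-n) : ℂ) - 1‖ ^ 4)⁻¹ * ‖∑ k : ZMod K, ((Δ_[1])^[4] f) k * ZMod.stdAddChar (k * n)‖)
      ≤ (K : ℝ)⁻¹ * ((‖(ZMod.stdAddChar (-n) : ℂ) - 1‖ ^ 4)⁻¹ * ∑ k : ZMod K, |(Δ_[2 * π / K])^[4] (heat (2 * s)) (cycAngle K k)|) := by
        gcongr
    _ = _ := by ring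

end Summit.QuantumFields.YangMills.BalabanUVNodes.N15KingModelRung.HeatKernel

end
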